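import Mathlib
import Summits.ValiantsHypothesis.ValiantsHypothesis.Theses.BarrierLever
import Summits.ValiantsHypothesis.ValiantsHypothesis.Theorems.BarrierLeverDefinableEquationsLevelOne
import Summits.ValiantsHypothesis.ValiantsHypothesis.Theorems.BarrierLeverDefinableEquationsRungOne
import Summits.ValiantsHypothesis.ValiantsHypothesis.Theorems.BarrierLeverDefinableEquationsInfinitelyOften

/-!
# Crux `BarrierLever.DefinableEquations` (stmt-ValiantsHypothesis-8745) — status after level
# reduction (lead c7): the crux rung by rung, its negation with ONE size exponent, and the lever on
# `SingleSizeEquations` infinitely often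

Consequences of `definableEquations_iff_singleSizeEquations` (level reduction by dilation,
`Theorems/BarrierLeverDefinableEquationsLevelOne.lean`), writing `Eq(n, b, a)` for the crux's inner
statement (a nonzero level-`a` boolean-sum equation against `SmallCircuits ℂ n b`, `N = C(2n,n)`):

* `definableEquations_iff_rungs` — the crux ↔ `∀ b ≥ 2, ∃ a n₀, ∀ n ≥ n₀, Eq(n, b, a)`: a list of
  INDEPENDENT open rungs, one per size exponent `b ≥ 2`, each with its own level `a(b)` (rungs
  `b ≤ 1` are the tree's `singleSizeEquations_of_le_one`); the first open rung is `b = 2`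
  ("some `poly(N)`-size boolean-sum equation for degree-`n` polynomials of circuit size `n²`,
  eventually in `n`" — Chatterjee–Tengse arXiv:2309.07612 §1.3 direction 2 at `VNP(poly N)`).
* `not_definableEquations_iff_oneExponent` — the crux FAILS iff ONE size exponent `b` makes the
  coefficient vectors of `SmallCircuits ℂ n b` hit every nonzero boolean sum of EVERY level `a`,
  infinitely often in `n` (lead c4's `Status.not_definableEquations_iff` had `∀ a ∃ b`; the exponent
  is now uniform in the level): a single `VP_n`-succinct hitting-set generator against all of
  `VNP(poly N)` i.o.; in particular (`isSuccinctHittingSet_io_of_not_definableEquations'`) one `b`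
  answering FSV Question 6 at every level infinitely often.
* `valiantsHypothesis_of_succinct_of_singleSize_io` — the assembly runs on
  `SuccinctHittingSetsForVP` and the `∀ b ∃ a`, infinitely-often form of the crux.

Pure logic over landed theorems; no definitions, no named facts.
-/

-- `Summit.ValiantsHypothesis.ValiantsHypothesis.…` repeats a component by the D-0017 layout
-- (single-conjunct summit), which the `dupNamespace` linter flags; the name is mandated.
set_option linter.dupNamespace false

noncomputable section

namespace Summit.ValiantsHypothesis.ValiantsHypothesis.Theorems.BarrierLeverDefinableEquations

open MvPolynomial
open Literature.Computability.AlgebraicComplexity Literature.Barriers.ValiantsHypothesis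
open Summit.ValiantsHypothesis.ValiantsHypothesis.Theses.BarrierLever
open scoped BigOperators

namespace LevelOneStatus

/-- **The crux rung by rung.**  `DefinableEquations` holds iff every size exponent `b ≥ 2` has SOME
level `a(b)` of nonzero boolean-sum equations against `SmallCircuits ℂ n b` for all large `n`
(`→`: instantiate; `←`: rungs `b ≤ 1` are `singleSizeEquations_of_le_one`, then level reduction
`definableEquations_of_singleSizeEquations`). [folklore] -/
theorem definableEquations_iff_rungs :
    DefinableEquations ↔
      ∀ b : ℕ, 2 ≤ b → ∃ a n₀ : ℕ, ∀ n ≥ n₀, ∃ q : ℕ, q ≤ (Nat.choose (2 * n) n) ^ a ∧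
        ∃ H : MvPolynomial (↥(degLEMonomials n) ⊕ Fin q) ℂ,
          complexity H ≤ (Nat.choose (2 * n) n) ^ a ∧ H.totalDegree ≤ (Nat.choose (2 * n) n) ^ a ∧
          boolSum H ≠ 0 ∧
          ∀ f ∈ SmallCircuits ℂ n b, eval (coeffVector (degLEMonomials n) f) (boolSum H) = 0 := by
  constructor
  · intro h b _
    exact Summit.ValiantsHypothesis.ValiantsHypothesis.Theorems.SingleSizeEquations.singleSizeEquations_of_definableEquations h b
  · intro h
    apply definableEquations_of_singleSizeEquations
    intro b
    by_cases hb : 2 ≤ b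
    · exact h b hb
    · exact singleSizeEquations_of_le_one b (by omega)

/-- **¬DefEq with ONE size exponent.**  The crux fails iff there is ONE size exponent `b` such that
for EVERY level `a`, for infinitely many `n`, every nonzero level-`a` boolean sum (`q ≤ N^a`,
`L(H), deg H ≤ N^a`) is nonzero at the coefficient vector of some `f ∈ SmallCircuits ℂ n b`
(negate `definableEquations_iff_singleSizeEquations`). [folklore] -/
theorem not_definableEquations_iff_oneExponent :
    ¬ DefinableEquations ↔
      ∃ b : ℕ, ∀ a n₀ : ℕ, ∃ n : ℕ, n₀ ≤ n ∧ ∀ q : ℕ, q ≤ (Nat.choose (2 * n) n) ^ a →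
        ∀ H : MvPolynomial (↥(degLEMonomials n) ⊕ Fin q) ℂ,
          complexity H ≤ (Nat.choose (2 * n) n) ^ a → H.totalDegree ≤ (Nat.choose (2 * n) n) ^ a →
          boolSum H ≠ 0 →
          ∃ f ∈ SmallCircuits ℂ n b, eval (coeffVector (degLEMonomials n) f) (boolSum H) ≠ 0 := by
  rw [definableEquations_iff_singleSizeEquations]
  constructor
  · intro h
    by_contra hcon
    push Not at hcon
    apply h
    intro b
    obtain ⟨a, n₀, hn₀⟩ := hcon b
    refine ⟨a, n₀, fun n hn => ?_⟩
    obtain ⟨q, hq, H, hH, hdeg, h0, hvan⟩ := hn₀ n hn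
    exact ⟨q, hq, H, hH, hdeg, h0, hvan⟩
  · rintro ⟨b, hb⟩ h
    obtain ⟨a, n₀, hn₀⟩ := h b
    obtain ⟨n, hn, hall⟩ := hb a n₀
    obtain ⟨q, hq, H, hH, hdeg, h0, hvan⟩ := hn₀ n hn
    obtain ⟨f, hf, hne⟩ := hall q hq H hH hdeg h0
    exact hne (hvan f hf)

/-- **Refuting the crux answers FSV Question 6 at every level with ONE size exponent, infinitely
often**: if `DefinableEquations` fails, some `b` makes the coefficient vectors of
`SmallCircuits ℂ n b` a succinct hitting set for `Distinguishers ℂ n a` for EVERY `a`, for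
infinitely many `n` (distinguishers are boolean sums with `q = 0`,
`SingleSizeEquations.distinguisher_isBoolSum`).  Compare the rank-2 crux `SuccinctHittingSetsForVP`
(`∀ a ∃ b`, for all large `n`). [folklore] -/
theorem isSuccinctHittingSet_io_of_not_definableEquations' (h : ¬ DefinableEquations) :
    ∃ b : ℕ, ∀ a n₀ : ℕ, ∃ n : ℕ, n₀ ≤ n ∧
      IsSuccinctHittingSet (degLEMonomials n) (SmallCircuits ℂ n b) (Distinguishers ℂ n a) := by
  obtain ⟨b, hb⟩ := not_definableEquations_iff_oneExponent.mp h
  refine ⟨b, fun a n₀ => ?_⟩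
  obtain ⟨n, hn, hall⟩ := hb a n₀
  refine ⟨n, hn, fun D hD hD0 => ?_⟩
  obtain ⟨hc, hdeg, hsum⟩ := Summit.ValiantsHypothesis.ValiantsHypothesis.Theorems.SingleSizeEquations.distinguisher_isBoolSum hD
  obtain ⟨f, hf, hne⟩ := hall 0 (Nat.zero_le _) _ hc hdeg (by rwa [hsum])
  exact ⟨f, hf, by rwa [hsum] at hne⟩

/-- **The lever runs on `SuccinctHittingSetsForVP` and the `∀ b ∃ a`, infinitely-often form of the
crux** (`InfinitelyOften.valiantsHypothesis_of_succinct_of_io` after level reduction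
`definableEquations_io_iff_singleSize_io`): the route's open load is exactly
`SuccinctHittingSetsForVP → (∀ b ∃ a, Eq(n, b, a) infinitely often)`. [folklore] -/
theorem valiantsHypothesis_of_succinct_of_singleSize_io
    (hSHS : Summit.ValiantsHypothesis.ValiantsHypothesis.Theses.BarrierLever.SuccinctHittingSetsForVP)
    (hio : ∀ b : ℕ, ∃ a : ℕ, ∀ n₀ : ℕ, ∃ n : ℕ, n₀ ≤ n ∧ ∃ q : ℕ, q ≤ (Nat.choose (2 * n) n) ^ a ∧
      ∃ H : MvPolynomial (↥(degLEMonomials n) ⊕ Fin q) ℂ,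
        complexity H ≤ (Nat.choose (2 * n) n) ^ a ∧ H.totalDegree ≤ (Nat.choose (2 * n) n) ^ a ∧
        boolSum H ≠ 0 ∧
        ∀ f ∈ SmallCircuits ℂ n b, eval (coeffVector (degLEMonomials n) f) (boolSum H) = 0) :
    _root_.ValiantsHypothesis :=
  InfinitelyOften.valiantsHypothesis_of_succinct_of_io hSHS
    (definableEquations_io_iff_singleSize_io.mpr hio)

/-- **Unconditional dichotomy, sharpened.**  Either ONE size exponent `b` hits every level of
boolean sums infinitely often (¬DefEq in its new form), or every `b` has level-ONE boolean-sum
equations for all large `n` (DefEq in its level-one normal form). [folklore] -/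
theorem oneExponent_hits_or_levelOne :
    (∃ b : ℕ, ∀ a n₀ : ℕ, ∃ n : ℕ, n₀ ≤ n ∧ ∀ q : ℕ, q ≤ (Nat.choose (2 * n) n) ^ a →
        ∀ H : MvPolynomial (↥(degLEMonomials n) ⊕ Fin q) ℂ,
          complexity H ≤ (Nat.choose (2 * n) n) ^ a → H.totalDegree ≤ (Nat.choose (2 * n) n) ^ a →
          boolSum H ≠ 0 →
          ∃ f ∈ SmallCircuits ℂ n b, eval (coeffVector (degLEMonomials n) f) (boolSum H) ≠ 0) ∨
    (∀ b : ℕ, ∃ n₀ : ℕ, ∀ n ≥ n₀, ∃ q : ℕ, q ≤ Nat.choose (2 * n) n ∧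
        ∃ H : MvPolynomial (↥(degLEMonomials n) ⊕ Fin q) ℂ,
          complexity H ≤ Nat.choose (2 * n) n ∧ H.totalDegree ≤ Nat.choose (2 * n) n ∧
          boolSum H ≠ 0 ∧
          ∀ f ∈ SmallCircuits ℂ n b, eval (coeffVector (degLEMonomials n) f) (boolSum H) = 0) := by
  by_cases h : DefinableEquations
  · exact Or.inr (definableEquations_iff_levelOne.mp h)
  · exact Or.inl (not_definableEquations_iff_oneExponent.mp h)

end LevelOneStatus

/-- **Registered sub-goal `not_definableEquations_iff_oneExponent` (verbatim signature).**  The crux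
fails iff ONE size exponent `b` makes coeff(`SmallCircuits ℂ n b`) hit every nonzero boolean sum of
every level, infinitely often in `n` (`LevelOneStatus.not_definableEquations_iff_oneExponent`). [folklore] -/
theorem not_definableEquations_iff_oneExponent :
    ¬ Summit.ValiantsHypothesis.ValiantsHypothesis.Theses.BarrierLever.DefinableEquations ↔ ∃ b : ℕ, ∀ a n₀ : ℕ, ∃ n : ℕ, n₀ ≤ n ∧ ∀ q : ℕ, q ≤ (Nat.choose (2 * n) n) ^ a → ∀ H : MvPolynomial (↥(Literature.Barriers.ValiantsHypothesis.degLEMonomials n) ⊕ Fin q) ℂ, Literature.Computability.AlgebraicComplexity.complexity H ≤ (Nat.choose (2 * n) n) ^ a → H.totalDegree ≤ (Nat.choose (2 * n) n) ^ a → Literature.Computability.AlgebraicComplexity.boolSum H ≠ 0 → ∃ f ∈ Literature.Barriers.ValiantsHypothesis.SmallCircuits ℂ n b, MvPolynomial.eval (Literature.Barriers.ValiantsHypothesis.coeffVector (Literature.Barriers.ValiantsHypothesis.degLEMonomials n) f) (Literature.Computability.AlgebraicComplexity.boolSum H) ≠ 0 :=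
  LevelOneStatus.not_definableEquations_iff_oneExponent

end Summit.ValiantsHypothesis.ValiantsHypothesis.Theorems.BarrierLeverDefinableEquations

end
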